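/- Lead seat `ym-line-cbag-p1` (prover-ym-line-cbag-p1-g18-0) of the sibling line `ColdBoxAllGroups` (planner-of-record ym-idea-2; own crux
`BoxFloorAllGroups` stmt-QuantumFields-22254 CLOSED): the ASSEMBLY item of route `SixPlaneColdBox` (stmt-QuantumFields-25710), proved from tree
theorems.  RECORD-type material; the Yang–Mills mass gap is NOT proved by anything here. -/
import Summits.QuantumFields.YangMills.Theses.SixPlaneColdBox
import Summits.QuantumFields.YangMills.Theorems.WeakCouplingRatesCurvatureCorrPowerFloor
import Summits.QuantumFields.YangMills.Theorems.SoloInformedNonFreezingFloor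

/-!
# Route `SixPlaneColdBox`, item `Assembly` (stmt-QuantumFields-25710): `BulkDominatesBoxDensityG → LatticeNonFreezing`

The route (LINE 3 of ideator ym-idea-2) targets the node `Theorems.LatticeNonFreezing` (Chatterjee, arXiv:1803.01950 Problem 5.1(b), typed
for the six-plane Wilson action density `r.curvature.F = actionDensity r.ρ`).  Its rank-0 target `BulkDominatesBoxDensityG` says: for some
window `0 < A < θ ≤ 1/100` and `η > 0`, for all large `β` and then all large odd tori `2S+1`, `β²`·(torus connected two-point function of the
action density at time separation `⌈β^A⌉`) `≥ η·β²·`(the cold-box covariance of the six-plane plaquette-cost sums at the centre of the box of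
half-side `⌈β^θ⌉` and its `⌈β^A⌉e₀`-translate).  This file proves the route's `Assembly` item — `BulkDominatesBoxDensityG` implies the
node — from three tree theorems and exponent bookkeeping:

* `ColdBoxAllGroups.boxActionDensityFloor_allGroups` (p601811): the cold-box Gaussian floor for the six-plane density,
  `c·C(⌈β^A⌉)² ≤ β²·Cov_box`, every `0 < A < θ ≤ 1/100`, eventually in `β`;
* `WeakCouplingRates.curvatureCorrPowerFloor_proof`: the lattice-Maxwell curvature floor `κ/n⁴ ≤ |C(n)|` for `n ≥ n₀`;
* `latticeNonFreezing_of_polynomialFloor` (`SoloInformedNonFreezingFloor`): a polynomial floor at polynomial separation beats every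
  exponential `C e^{−μ n}`.

Bookkeeping (`polynomialFloorWitness_of_bulkDominatesBoxDensityG`): with `n = ⌈β^A⌉ ≤ 2β^A` the torus two-point function is
`≥ (ηcκ²/256)·β^{−(2+8A)}`; `k = ⌈1/A⌉` gives `β ≤ n^k` (`ColdBoxAllGroups.le_ceil_rpow_pow_ceil_inv`), `p = ⌈2+8A⌉`, spatial offset
`y = 0` (`configShift (-0) = id`), and `S₀` is raised to `≥ n`; this is `PolynomialFloorWitness` for the species `r.curvature.F`, whence
the node.  (The single-plaquette model of exactly this arithmetic is `ColdBoxAllGroups.plaquettePolynomialFloor_allGroups`.)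

An implication only: neither `BulkDominatesBoxDensityG` nor the route's cruxes `TorusMeanNearColdBoxG` / `DensityTransferG` is proved
here, and the node `LatticeNonFreezing` stays open.  No sorry; standard axioms.  NOT the Yang–Mills mass gap (lower bounds on correlations
are the trivial half of asymptotic scaling); no summit statement is proved.
-/

set_option autoImplicit false

noncomputable section

open MeasureTheory Filter Topology
open Literature.MathematicalPhysics.QuantumFieldTheory
open Literature.MathematicalPhysics.QuantumLattice
open Summit.QuantumFields.YangMills.Theorems.WeakCouplingRates

namespace Summit.QuantumFields.YangMills.Theorems.SixPlaneColdBox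

/-! ### Exponent bookkeeping -/

/-- If `X / β^{8A} ≤ β²·t` with `1 ≤ β` and `0 ≤ X`, then `t ≥ 0` and `X ≤ β^{⌈2+8A⌉₊}·|t|`. -/
theorem le_pow_ceil_mul_abs_of_div_rpow_le {β A X t : ℝ} (hβ : 1 ≤ β) (hX : 0 ≤ X)
    (h : X / β ^ (8 * A) ≤ β ^ 2 * t) : X ≤ β ^ (⌈2 + 8 * A⌉₊ : ℕ) * |t| := by
  have hβ0 : 0 < β := one_pos.trans_le hβ
  have h8 : 0 < β ^ (8 * A) := Real.rpow_pos_of_pos hβ0 _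
  -- `X ≤ β^{8A}·(β²·t)`
  have h1 : X ≤ β ^ (8 * A) * (β ^ 2 * t) := by
    have := mul_le_mul_of_nonneg_left h h8.le
    rwa [mul_div_cancel₀ _ h8.ne'] at this
  -- `t ≥ 0`, so `|t| = t`
  have ht : 0 ≤ t := by
    by_contra hcon
    push Not at hcon
    have : β ^ (8 * A) * (β ^ 2 * t) < 0 :=
      mul_neg_of_pos_of_neg h8 (mul_neg_of_pos_of_neg (by positivity) hcon)
    linarith
  rw [abs_of_nonneg ht]
  -- `β^{8A}·β² ≤ β^{⌈2+8A⌉₊}`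
  have hexp : β ^ (8 * A) * β ^ 2 ≤ β ^ (⌈2 + 8 * A⌉₊ : ℕ) := by
    have hp : 2 + 8 * A ≤ (⌈2 + 8 * A⌉₊ : ℝ) := Nat.le_ceil _
    calc β ^ (8 * A) * β ^ 2 = β ^ (8 * A) * β ^ (2 : ℝ) := by rw [Real.rpow_two]
      _ = β ^ (2 + 8 * A) := by rw [← Real.rpow_add hβ0]; ring_nf
      _ ≤ β ^ ((⌈2 + 8 * A⌉₊ : ℕ) : ℝ) := Real.rpow_le_rpow_of_exponent_le hβ hp
      _ = β ^ (⌈2 + 8 * A⌉₊ : ℕ) := Real.rpow_natCast _ _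
  calc X ≤ β ^ (8 * A) * (β ^ 2 * t) := h1
    _ = (β ^ (8 * A) * β ^ 2) * t := by ring
    _ ≤ β ^ (⌈2 + 8 * A⌉₊ : ℕ) * t := mul_le_mul_of_nonneg_right hexp ht

/-- The curvature floor squared at the separation `n = ⌈β^A⌉ ≤ 2β^A` (`1 ≤ β`, `0 ≤ A`): `κ/n⁴ ≤ |C|` gives `κ²/256 / β^{8A} ≤ C²`. -/
theorem curvature_sq_floor_at_ceil {β A κ Cn : ℝ} (hβ : 1 ≤ β) (hA : 0 ≤ A) (hκ : 0 ≤ κ)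
    (hC : κ / ((⌈β ^ A⌉₊ : ℕ) : ℝ) ^ 4 ≤ |Cn|) : κ ^ 2 / 256 / β ^ (8 * A) ≤ Cn ^ 2 := by
  have hβ0 : 0 < β := one_pos.trans_le hβ
  have hA0 : 0 < β ^ A := Real.rpow_pos_of_pos hβ0 A
  have hA1 : 1 ≤ β ^ A := Real.one_le_rpow hβ hA
  have hT_ge : β ^ A ≤ ((⌈β ^ A⌉₊ : ℕ) : ℝ) := Nat.le_ceil _
  have hT_lt : ((⌈β ^ A⌉₊ : ℕ) : ℝ) < β ^ A + 1 := Nat.ceil_lt_add_one hA0.le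
  have hT_le : ((⌈β ^ A⌉₊ : ℕ) : ℝ) ≤ 2 * β ^ A := by linarith
  have hT0 : 0 < ((⌈β ^ A⌉₊ : ℕ) : ℝ) := lt_of_lt_of_le (lt_of_lt_of_le one_pos hA1) hT_ge
  -- `(κ/n⁴)² ≤ C²`
  have hsq : (κ / ((⌈β ^ A⌉₊ : ℕ) : ℝ) ^ 4) ^ 2 ≤ Cn ^ 2 := by
    rw [← sq_abs Cn]
    exact pow_le_pow_left₀ (div_nonneg hκ (by positivity)) hC 2
  -- `n⁸ ≤ (2β^A)⁸ = 256·β^{8A}`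
  have hT8 : ((⌈β ^ A⌉₊ : ℕ) : ℝ) ^ 8 ≤ (2 * β ^ A) ^ (8 : ℕ) := pow_le_pow_left₀ hT0.le hT_le 8
  have hpow : (β ^ A) ^ (8 : ℕ) = β ^ (8 * A) := by
    rw [← Real.rpow_mul_natCast hβ0.le]
    norm_num
    ring_nf
  calc κ ^ 2 / 256 / β ^ (8 * A) = κ ^ 2 / (2 * β ^ A) ^ (8 : ℕ) := by
        rw [mul_pow, hpow]; norm_num; ring
    _ ≤ κ ^ 2 / ((⌈β ^ A⌉₊ : ℕ) : ℝ) ^ 8 := div_le_div_of_nonneg_left (by positivity) (by positivity) hT8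
    _ = (κ / ((⌈β ^ A⌉₊ : ℕ) : ℝ) ^ 4) ^ 2 := by field_simp
    _ ≤ Cn ^ 2 := hsq

/-! ### The polynomial floor for the six-plane density from `BulkDominatesBoxDensityG` -/

/-- **`BulkDominatesBoxDensityG` gives a polynomial floor at polynomial separation for the six-plane action density** — the statement
`PolynomialFloorWitness` of `SoloInformedNonFreezingFloor` (species `r.curvature.F`): for every compact simple `G` and faithful unitary lattice
representation `r` there are `k p : ℕ` and `c' > 0` (`k = ⌈1/A⌉`, `p = ⌈2+8A⌉`, `c' = ηcκ²/256`) such that for all large `β`, on every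
large torus of side `2S+1`, the origin density and its time-translate by `n = ⌈β^A⌉ ≤ S` (`β ≤ n^k`, spatial offset `y = 0`) have truncated
correlation `≥ c'β^{-p}` in modulus.  Inputs: the landed cold-box floor `ColdBoxAllGroups.boxActionDensityFloor_allGroups` at the window
`(A, θ)` of the hypothesis, the curvature floor `curvatureCorrPowerFloor_proof`, and arithmetic.  NOT the Clay gap. -/
theorem polynomialFloorWitness_of_bulkDominatesBoxDensityG
    (h : Summit.QuantumFields.YangMills.Theses.SixPlaneColdBox.BulkDominatesBoxDensityG) : PolynomialFloorWitness := by
  intro G _ _ _ _ hG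
  letI : MeasurableSpace G := borel G
  haveI : BorelSpace G := ⟨rfl⟩
  intro r
  -- unpack the BULK-DENSITY hypothesis at `(G, r)`
  have hX := h G hG r
  obtain ⟨A, θ, η, hA, hAθ, hθ1, hη, β₀, hX⟩ := hX
  -- the landed cold-box floor for the six-plane density at the same window
  have hbox' := ColdBoxAllGroups.boxActionDensityFloor_allGroups G hG r A θ hA hAθ hθ1
  obtain ⟨c, hc, β₀', hbox⟩ := hbox'
  -- the lattice-Maxwell curvature floor
  obtain ⟨κ, hκ, n₀, hF⟩ := curvatureCorrPowerFloor_proof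
  refine ⟨⌈1 / A⌉₊, ⌈2 + 8 * A⌉₊, η * c * κ ^ 2 / 256, by positivity, ?_⟩
  -- one threshold in `β`: both floors available, `1 ≤ β`, and `n₀ ≤ β^A`
  have hev : ∀ᶠ β : ℝ in atTop, β₀ ≤ β ∧ β₀' ≤ β ∧ 1 ≤ β ∧ (n₀ : ℝ) ≤ β ^ A := by
    filter_upwards [eventually_ge_atTop β₀, eventually_ge_atTop β₀', eventually_ge_atTop (1 : ℝ),
      (tendsto_rpow_atTop hA).eventually_ge_atTop (n₀ : ℝ)] with β h1 h2 h3 h4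
    exact ⟨h1, h2, h3, h4⟩
  obtain ⟨β₁, hβ₁⟩ := Filter.eventually_atTop.1 hev
  refine ⟨β₁, fun β hβ => ?_⟩
  obtain ⟨hb₀, hb₀', hβ1, hn₀⟩ := hβ₁ β hβ
  obtain ⟨S₀, hS₀⟩ := hX β hb₀
  refine ⟨max S₀ ⌈β ^ A⌉₊, fun S hS => ?_⟩
  have hSS : S₀ ≤ S := (le_max_left _ _).trans hS
  refine ⟨⌈β ^ A⌉₊, 0, ColdBoxAllGroups.le_ceil_rpow_pow_ceil_inv hβ1 hA, (le_max_right _ _).trans hS, rfl, ?_⟩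
  -- the three inequalities at `β`, `S`, `n = ⌈β^A⌉`
  have hdom := hS₀ S hSS
  have hfl := hbox β hb₀'
  have hn₀' : n₀ ≤ ⌈β ^ A⌉₊ := by
    have : (n₀ : ℝ) ≤ ((⌈β ^ A⌉₊ : ℕ) : ℝ) := hn₀.trans (Nat.le_ceil _)
    exact_mod_cast this
  have hCn := hF ⌈β ^ A⌉₊ hn₀'
  have hC2 := curvature_sq_floor_at_ceil (Cn := curvaturePlaquetteCorr (d := 4) (by norm_num) ((⌈β ^ A⌉₊ : ℕ) : ℤ))
    hβ1 hA.le hκ.le hCn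
  -- the spatial offset `y = 0` is no shift, and the species is the action density
  have hshift : (fun U : LGConfig 4 G => r.curvature.F (configShift (-(0 : Literature.Probability.LatticeModels.Site 4)) U)) =
      actionDensity r.ρ := by
    funext U
    show actionDensity r.ρ _ = actionDensity r.ρ U
    congr 1
    funext e
    simp
  rw [hshift]
  show η * c * κ ^ 2 / 256 ≤ β ^ ⌈2 + 8 * A⌉₊ *
    |latticeConnectedCorr r.ρ β (2 * S + 1) (actionDensity r.ρ) (actionDensity r.ρ) ⌈β ^ A⌉₊|
  -- chain: `ηcκ²/256 / β^{8A} ≤ η·c·C² ≤ η·(β²·Cov_box) ≤ β²·corr`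
  refine le_pow_ceil_mul_abs_of_div_rpow_le hβ1 (by positivity) ?_
  have h1 : η * c * κ ^ 2 / 256 / β ^ (8 * A) = η * (c * (κ ^ 2 / 256 / β ^ (8 * A))) := by ring
  rw [h1]
  refine le_trans ?_ hdom
  refine mul_le_mul_of_nonneg_left ?_ hη.le
  exact le_trans (mul_le_mul_of_nonneg_left hC2 hc.le) hfl

/-! ### The item -/

/-- **Item `Assembly` of route `SixPlaneColdBox`** (stmt-QuantumFields-25710): `BulkDominatesBoxDensityG → LatticeNonFreezing` — the BULK
transfer for the six-plane density (the route's rank-0 target, OPEN; it rests on the cruxes `TorusMeanNearColdBoxG` and `DensityTransferG`)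
implies Chatterjee's non-freezing node for every compact simple `G`: the landed cold-box floor for the density, the curvature-kernel floor and
the exponent bookkeeping give `PolynomialFloorWitness` (`polynomialFloorWitness_of_bulkDominatesBoxDensityG`), and a polynomial floor at
polynomial separation beats every exponential (`latticeNonFreezing_of_polynomialFloor`).  An implication only; NOT the Clay gap; the node is
not proved here. -/
theorem assembly_proof : Summit.QuantumFields.YangMills.Theses.SixPlaneColdBox.Assembly :=
  fun h => latticeNonFreezing_of_polynomialFloor (polynomialFloorWitness_of_bulkDominatesBoxDensityG h)

end Summit.QuantumFields.YangMills.Theorems.SixPlaneColdBox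

end
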